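import Summits.CriticalPhenomena.Ising3DConformalLimit.Theorems.SynchronousCouplingRotationJoiningL2Gluing

/-!
# Route `SynchronousCoupling`, crux `RotationJoining` (stmt-CriticalPhenomena-18763), line `SketchIdeator2`:
gluing two probability spaces along a common law (tool for `stub_qualitativeOfFDDIsotropy`)

Pure measure theory, no lattice input. If `X : Ω → E` under `P` and `Y : Ω' → E` under `Q` have the same law
(`P.map X = Q.map Y`), with `Ω, Ω'` standard Borel and the diagonal of `E` measurable, then there is a coupling `T`
of `P` and `Q` on `Ω × Ω'` under which `X ∘ fst = Y ∘ snd` almost surely (Villani 2009, Ch. 1, gluing along a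
common marginal): glue the graph couplings `P.map (ω ↦ (ω, X ω))` on `Ω × E` and `Q.map (ω ↦ (Y ω, ω))` on
`E × Ω'` along their common middle marginal with the landed triple gluing lemma `exists_glued_triple`, and project
the triple law to `Ω × Ω'`. `stub_equalLawGluing` is the registered specialisation to the chain spaces
`ℕ → SpinConfig (Site 3)` and `E = Fin d → ℝ`.
-/

noncomputable section

namespace Summit.CriticalPhenomena.Ising3DConformalLimit.Cruxes.RotationJoining.RateSplitting

open MeasureTheory ProbabilityTheory

section EqualLaw

variable {Ω Ω' E : Type*} [MeasurableSpace Ω] [MeasurableSpace Ω'] [MeasurableSpace E]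

/-- **Gluing along a common law.** If `X` under `P` and `Y` under `Q` have the same law in a space `E` with
measurable diagonal (`Ω, Ω'` standard Borel, `P, Q` finite), then some coupling `T` of `P` and `Q` satisfies
`X p.1 = Y p.2` for `T`-a.e. `p`. -/
theorem exists_coupling_ae_eq [StandardBorelSpace Ω] [Nonempty Ω] [StandardBorelSpace Ω'] [Nonempty Ω']
    [MeasurableEq E] (P : Measure Ω) (Q : Measure Ω') [IsFiniteMeasure P] [IsFiniteMeasure Q]
    {X : Ω → E} {Y : Ω' → E} (hX : Measurable X) (hY : Measurable Y) (h : P.map X = Q.map Y) :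
    ∃ T : Measure (Ω × Ω'), T.fst = P ∧ T.snd = Q ∧ ∀ᵐ p ∂T, X p.1 = Y p.2 := by
  have hg : Measurable (fun ω : Ω => (ω, X ω)) := measurable_id.prodMk hX
  have hg' : Measurable (fun ω : Ω' => (Y ω, ω)) := hY.prodMk measurable_id
  -- the two graph couplings share the middle marginal `P.map X = Q.map Y`
  have hmid : (P.map (fun ω => (ω, X ω))).map Prod.snd = (Q.map (fun ω => (Y ω, ω))).map Prod.fst := by
    rw [Measure.map_map measurable_snd hg, Measure.map_map measurable_fst hg']
    exact h
  obtain ⟨ρ, h12, h23⟩ := exists_glued_triple (P.map (fun ω => (ω, X ω))) (Q.map (fun ω => (Y ω, ω))) hmid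
  have hf12 : Measurable (fun p : E × (Ω × Ω') => (p.2.1, p.1)) := measurable_snd.fst.prodMk measurable_fst
  have hf23 : Measurable (Prod.map id Prod.snd : E × (Ω × Ω') → E × Ω') := measurable_id.prodMap measurable_snd
  refine ⟨ρ.snd, ?_, ?_, ?_⟩
  · -- first marginal
    calc ρ.snd.fst = (ρ.map (fun p => (p.2.1, p.1))).fst := by
          rw [Measure.snd, Measure.fst, Measure.fst, Measure.map_map measurable_fst measurable_snd,
            Measure.map_map measurable_fst hf12]
          rfl
      _ = P := by
          rw [h12, Measure.fst, Measure.map_map measurable_fst hg]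
          exact Measure.map_id
  · -- second marginal
    calc ρ.snd.snd = (ρ.map (Prod.map id Prod.snd)).snd := by
          rw [Measure.snd, Measure.snd, Measure.snd, Measure.map_map measurable_snd measurable_snd,
            Measure.map_map measurable_snd hf23]
          rfl
      _ = Q := by
          rw [h23, Measure.snd, Measure.map_map measurable_snd hg']
          exact Measure.map_id
  · -- almost sure identity: `X p.2.1 = p.1 = Y p.2.2` for `ρ`-a.e. `p`, then project
    have h1 : ∀ᵐ p ∂ρ, X p.2.1 = p.1 := by
      have hS : MeasurableSet {q : Ω × E | X q.1 = q.2} :=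
        measurableSet_eq_fun (hX.comp measurable_fst) measurable_snd
      have hae : ∀ᵐ q ∂(ρ.map (fun p => (p.2.1, p.1))), X q.1 = q.2 := by
        rw [h12]
        exact (ae_map_iff hg.aemeasurable hS).2 (ae_of_all _ fun ω => rfl)
      filter_upwards [ae_of_ae_map hf12.aemeasurable hae] with p hp using hp
    have h2 : ∀ᵐ p ∂ρ, p.1 = Y p.2.2 := by
      have hS : MeasurableSet {q : E × Ω' | q.1 = Y q.2} :=
        measurableSet_eq_fun measurable_fst (hY.comp measurable_snd)
      have hae : ∀ᵐ q ∂(ρ.map (Prod.map id Prod.snd)), q.1 = Y q.2 := by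
        rw [h23]
        exact (ae_map_iff hg'.aemeasurable hS).2 (ae_of_all _ fun ω => rfl)
      filter_upwards [ae_of_ae_map hf23.aemeasurable hae] with p hp using hp
    have hS3 : MeasurableSet {q : Ω × Ω' | X q.1 = Y q.2} :=
      measurableSet_eq_fun (hX.comp measurable_fst) (hY.comp measurable_snd)
    rw [Measure.snd]
    refine (ae_map_iff measurable_snd.aemeasurable hS3).2 ?_
    filter_upwards [h1, h2] with p h1p h2p
    exact h1p.trans h2p

end EqualLaw

/-! ### Registered specialisation to the chain spaces over Ising configurations on `ℤ³` -/

open Literature.Probability.LatticeModels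

/-- **Registered sub-goal `stub_equalLawGluing`** (tool of `stub_qualitativeOfFDDIsotropy`): gluing two
probability measures on the chain space `ℕ → SpinConfig (Site 3)` along a common `ℝ^d`-valued law. -/
theorem stub_equalLawGluing :
    ∀ (d : ℕ) (P Q : Measure (ℕ → SpinConfig (Site 3))) [IsProbabilityMeasure P] [IsProbabilityMeasure Q]
      (X Y : (ℕ → SpinConfig (Site 3)) → (Fin d → ℝ)), Measurable X → Measurable Y → P.map X = Q.map Y →
      ∃ T : Measure ((ℕ → SpinConfig (Site 3)) × (ℕ → SpinConfig (Site 3))), T.fst = P ∧ T.snd = Q ∧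
        ∀ᵐ p ∂T, X p.1 = Y p.2 :=
  fun _ P Q _ _ _ _ hX hY h => exists_coupling_ae_eq P Q hX hY h

end Summit.CriticalPhenomena.Ising3DConformalLimit.Cruxes.RotationJoining.RateSplitting

end
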